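import Literature.AlgebraicGeometry.Motives.AbelianVarietyDihedralCentralKleinBrauerRelation
import Literature.RepresentationTheory.FiniteGroups.PCubedCharacterDegrees
import Literature.RepresentationTheory.FiniteGroups.ExtraspecialCharacterDegrees
import HarnessLib

/-!
# The HEISENBERG relation of Tornehave–Bouc / Bartel–Dokchitser's Theorem A, Case 2: for a non-abelian group of
# order `p³` and two non-central subgroups `I, J` of order `p`, `Θ = I − IZ − J + JZ` (`Z = Z(G) ≅ C_p`) is a Brauer
# relation — via the central-translation criterion for a central element of PRIME order; the named relations
# `Θ_j = ⟨y⟩ − ⟨xy^j⟩ − ⟨y, z⟩ + ⟨xy^j, z⟩` on the Heisenberg group of order `p³`, and the Kani–Rosen isogeny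
# `B_I × B_{JZ} ∼ B_J × B_{IZ}`

Layer A1/A2 of the Hodge foundations lane (`lit-hodgefound`, row A1-20⁺ · A2, seat p03 generation 28, row g28-#3) on
the ALGEBRAIC carrier; sequel of `Motives/AbelianVarietyDihedralCentralKleinBrauerRelation` (g28-#1: Case 1, the
dihedral relation, through a criterion for a central INVOLUTION — CONSUMED: `card_conj_mem_eq_zero_of_mem_center`, the
marks dictionary `indClassFun_one_apply_eq_div`, `card_conj_mem_one_eq`, `card_conj_mem_eq_of_zpowers_conj_eq`, the
Kani–Rosen engine `sum_mul_finrank_hom_eq_of_sum_smul_indClassFun_one_eq`, `finrank_hom_biprod`, `dim_biprod`,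
`isIsogenous_iff_forall_finrank_hom_eq'`) and of the tree's group theory of order `p³`
(`RepresentationTheory/FiniteGroups/PCubedCharacterDegrees`: `PCubed.card_center` (`|Z(G)| = p`),
`PCubed.commutator_le_center` (`G' ≤ Z(G)`), the model `Heis (LinearMap.mul (ZMod p) (ZMod p))` of order `p³`
(`PCubed.natCard_heis_zmod`, `PCubed.heis_zmod_nonabelian`); `…/ExtraspecialCharacterDegrees`:
`Extraspecial.exists_hom_commutator` (Dornhoff's `φ_x : y ↦ [x, y]` is a homomorphism when `G' ≤ Z(G)`)).  §1 redoes
§1 of g28-#1 for a central element `z` of PRIME order `p` (`H⟨z⟩ = ⨆_{k<p} Hz^k`, marks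
`m_{H⟨z⟩}(g) = Σ_{k<p} m_H(z^k g)`, `p·(1_{H⟨z⟩})^G(g) = Σ_{k<p} (1_H)^G(z^k g)`, and the criterion "`D = (1_H)^G − (1_{H'})^G`
invariant under `g ↦ zg` ⟹ `H − H' + H'Z − HZ ∈ K(G)`"); §2 isolates the mechanism at work in the Heisenberg group —
**if `|H| = |H'|`, `z ∉ H, H'`, and every `g ∉ ⟨z⟩` is CONJUGATE to `zg`, then `Θ` is a relation** (off `⟨z⟩` the two
permutation characters are separately `z`-invariant, being class functions; on `⟨z⟩` both equal `[G:H]δ_1`); §3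
verifies the hypothesis in every non-abelian group of order `p³` (the class of a non-central `g` is the whole coset
`gZ(G)`, because `y ↦ [g, y]` is a homomorphism ONTO `Z(G) ≅ C_p`) and concludes Theorem A's Case 2 / Theorem 4 (2);
§4 exhibits Bartel–Dokchitser's generators `Θ_j` on the tree's Heisenberg group; §5 is Kani–Rosen.  Everything here is
PROVED; NO definition, NO named fact (net Literature debt 0).

## Sources, verbatim

A. Bartel, T. Dokchitser, *Brauer relations in finite groups*, J. Eur. Math. Soc. **17** (2015) (arXiv 1103.2047, held
`paper:arxiv-1103.2047`).  Theorem A (p0003): "A finite non-cyclic group `G` has a primitive relation if and only if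
either (1) `G` is dihedral of order `2^n ≥ 8`; or **(2) `G = (C_p × C_p) ⋊ C_p` is the Heisenberg group of order `p³`
with `p ≥ 3`**; or (3) […]. Case 2: `Prim(G) = (ℤ/pℤ)^p`, basis of `Prim(G)`:
**`Θ_j = ⟨y⟩ − ⟨xy^j⟩ − ⟨y, z⟩ + ⟨xy^j, z⟩`, `1 ≤ j ≤ p`, `G = ⟨x, z⟩ ⋊ ⟨y⟩`, `z ∈ Z(G)`**."  Theorem B (p0005): "(3) `C` is
cyclic, `Q` is an abelian `p`-group, `H, H' ≤ G` meet `C` trivially, `|H| = |H'|`, and `Θ = Σ_{U ≤ C} μ(|U|)(UH − UH')`.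
Conversely, all `Θ ∈ B(G)` of the listed type are Brauer relations, not necessarily primitive."  §5 Theorem 4
(Tornehave–Bouc) (p0010): "All Brauer relations in `p`-groups are `ℤ`-linear combinations of ones lifted from
subquotients `P` of the following types: (1) `P ≅ C_p × C_p` […]; **(2) `P` is the Heisenberg group of order `p³`, and
the relation is `I − IZ − J + JZ` where `Z = Z(P)` and `I` and `J` are two non-conjugate non-central subgroups of order
`p`**; (3) `P ≅ D_{2^n}` […]."; its proof: "any occurrence in a relation of a subgroup that does not contain `Z_p` […]
can be replaced […] using a relation from a subquotient isomorphic to the Heisenberg group of order `p³`."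
L. Dornhoff, *Group Representation Theory A* (1971), §31, proof of Lemma 31.4 (tree `Extraspecial.exists_hom_commutator`,
`index_centralizer`): "define `φ_x : z → [x, z]` […] `φ_x` is a homomorphism. Since `x ∉ Z(P)` and `|P'| = p`, `φ_x` is
onto `P'`".  G. James, M. Liebeck, *Representations and Characters of Groups* (2001), Ch. 26 p. 301 (tree `PCubed`):
"`Z ≠ {1}` and `G/Z` is non-cyclic. Hence `G/Z ≅ C_p × C_p` and `Z ≅ C_p`".  E. Kani, M. Rosen, *Idempotent relations
and factors of Jacobians*, Math. Ann. **284** (1989), Thm. 3.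

## The proof used here (stated so as not to hide the deviation from the source)

Bartel–Dokchitser obtain Case 2 inside their analysis of `p`-groups (Theorem 4, via Bouc's moving lemma) and verify
the table of Theorem A in §§6–7 by character computations.  Here: for `z` central of prime order `p` and `z ∉ H`,
`p·(1_{H⟨z⟩})^G(g) = Σ_{k<p}(1_H)^G(z^k g)` (§1), so `Θ = H − H' + H'Z − HZ` vanishes as a virtual permutation character
as soon as `D = (1_H)^G − (1_{H'})^G` is invariant under translation by `z`; for `|H| = |H'|` both characters equal
`[G:H]·δ_1` on `⟨z⟩` (they meet `⟨z⟩` trivially), and off `⟨z⟩` each is `z`-invariant whenever `g` and `zg` are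
conjugate (§2).  In a non-abelian group of order `p³` the centre has order `p` and `G' ≤ Z(G)` (tree), so for `g ∉ Z(G)`
the homomorphism `y ↦ [g, y]` has image a non-trivial subgroup of `Z(G) ≅ C_p`, i.e. all of it: some `y` has
`[g, y] = z⁻¹`, i.e. `ygy⁻¹ = zg` (§3, `exists_conj_eq_mul_of_not_mem_center`).  Non-conjugacy of `I` and `J` is not
needed for `Θ` to be a relation (for conjugate `I, J` it is the zero element of `B(G)`); it is what makes `Θ` non-zero,
and is verified for the named generators in §4.

## Dictionary and what is proved (namespace `Literature.AlgebraicGeometry.Motives.AbelianVariety`)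

`(1_H)^G = indClassFun H 1`, `m_H(g) = Nat.card {x // x⁻¹ * g * x ∈ H}`, `⟨z⟩ = Subgroup.zpowers z`, `HZ = H ⊔ zpowers z`.

* §1 (`z ∈ Z(G)`, `orderOf z = p` prime, `z ∉ H`) `pow_mem_iff_dvd_of_not_mem` (`z^m ∈ H ↔ p ∣ m`),
  `inf_zpowers_eq_bot_of_prime` (`H ∩ ⟨z⟩ = 1`), `mem_sup_zpowers_iff_exists_lt` (`x ∈ H⟨z⟩ ↔ ∃ k < p, xz^k ∈ H`),
  `card_sup_zpowers_of_prime` (`|H⟨z⟩| = p|H|`), **`card_conj_mem_sup_zpowers_eq_sum`** (`m_{H⟨z⟩}(g) = Σ_{k<p} m_H(z^k g)`),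
  **`prime_mul_indClassFun_sup_zpowers_one_apply`** (`p(1_{H⟨z⟩})^G(g) = Σ_{k<p}(1_H)^G(z^kg)`),
  **`indClassFun_add_indClassFun_sup_zpowers_eq_of_forall_prime`** (the criterion).
* §2 `indClassFun_one_apply_of_mem_zpowers_center` (`(1_H)^G(ζ) = [G:H]·[ζ = 1]` for `ζ ∈ ⟨z⟩`),
  **`indClassFun_add_indClassFun_sup_zpowers_eq_of_conj_mul`** (THE MECHANISM: `|H| = |H'|`, `z ∉ H, H'`, every
  `g ∉ ⟨z⟩` conjugate to `zg` ⟹ `(1_H)^G + (1_{H'Z})^G = (1_{H'})^G + (1_{HZ})^G`).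
* §3 (`|G| = p³`, `G` non-abelian) `center_eq_zpowers_of_card_eq_prime_cube` (`Z(G) = ⟨z⟩` for any central `z ≠ 1`),
  `orderOf_eq_of_mem_center_of_card_eq_prime_cube`, **`exists_conj_eq_mul_of_not_mem_center`** (`g ∉ Z(G)`, `z ∈ Z(G)`
  ⟹ `∃ y, ygy⁻¹ = zg`: the class of `g` is `gZ(G)`), `not_mem_of_card_eq_prime_of_not_le_center` (a non-central
  subgroup of order `p` meets `Z(G)` trivially), **`indClassFun_add_indClassFun_sup_center_eq_of_card_eq_prime_cube`**
  (THEOREM A CASE 2 / THEOREM 4 (2): `(1_I)^G + (1_{J Z(G)})^G = (1_J)^G + (1_{I Z(G)})^G`), `sum_theta_smul_indClassFun_pCubed_eq_zero`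
  (signed form `Θ = ![1, −1, −1, 1]` on `![I, J, IZ, JZ]`).
* §4 (the tree's Heisenberg group `Heis (LinearMap.mul (ZMod p) (ZMod p))`, `p` an odd prime; `y = (0,1,0)`,
  `x_j = (1,j,0)`) `heis_y_pow`, `heis_xj_pow`, `orderOf_heis_y`, `orderOf_heis_xj` (order `p`), `zpowers_heis_y_not_le_center`,
  `zpowers_heis_xj_not_le_center` (non-central), **`zpowers_heis_xj_ne_map_conj_zpowers_heis_y`**,
  **`zpowers_heis_xj_ne_map_conj_zpowers_heis_xj`** (`j ≠ j'`: pairwise non-conjugate — `p + 1` classes),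
  **`indClassFun_heis_theta_j`** (Bartel–Dokchitser's `Θ_j`, `j ∈ ℤ/p`, are relations).
* §5 Kani–Rosen: **`finrank_hom_pCubed`** (any field: `rk Hom(B_I, B) + rk Hom(B_{JZ}, B) = rk Hom(B_J, B) + rk Hom(B_{IZ}, B)`),
  **`isIsogenous_pCubed`** (`B_I × B_{JZ} ∼ B_J × B_{IZ}` over a perfect field), `dim_pCubed`.

Scope (stated, not hidden).  (1) PRIMITIVITY and `Prim(G) ≅ (ℤ/pℤ)^p` are not formalised (no imprimitive-lattice
functor in the tree); what is proved is that the `Θ`'s ARE relations ("Conversely, all `Θ` … are Brauer relations")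
and that the named `I = ⟨y⟩`, `J = ⟨xy^j⟩` are non-central, of order `p`, pairwise non-conjugate.  (2) §3 is stated for
every non-abelian group of order `p³` and every prime `p` (for `p = 2` it re-proves `D_4`'s dihedral relation of
g28-#1/#2; for the other non-abelian group `C_{p²} ⋊ C_p` of odd order `p³` all non-central subgroups of order `p`
are conjugate, so `Θ = 0` in `B(G)` there — consistent with Theorem A listing only the Heisenberg group).  (3) The
tree's `Heis` carries Cohn–Umans' law `(x,y,α)(u,v,β) = (x+u, y+v, α+β+2uy)`; for odd `p` it is non-abelian of
order `p³` and exponent `p`, i.e. the Heisenberg group (the identification with `(C_p × C_p) ⋊ C_p` is not spelled out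
beyond `|G| = p³`, non-abelian, and the generators having order `p`).

## References

* [BartelDokchitser2015] A. Bartel, T. Dokchitser, *Brauer relations in finite groups*, JEMS 17 (2015), §1.1 Theorem A
  (Case 2), Theorem B (3), §5 Theorem 4 (Tornehave–Bouc) (2).
* [Dornhoff1971] L. Dornhoff, *Group Representation Theory, Part A*, Dekker 1971, §31 (Lemma 31.1, proof of Lemma 31.4).
* [JamesLiebeck2001] G. James, M. Liebeck, *Representations and Characters of Groups*, 2nd ed. 2001, Ch. 26 (p. 301).
* [KaniRosen1989] E. Kani, M. Rosen, *Idempotent relations and factors of Jacobians*, Math. Ann. 284 (1989), Thm. 3.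
* [DokchitserEtAl2022] V. Dokchitser, H. Green, A. Konstantinou, A. Morgan, *Parity of ranks of Jacobians of curves*,
  arXiv:2211.06357, §1.3 Thm. 1.3.
-/

noncomputable section

universe u

open scoped commutatorElement
open CategoryTheory CategoryTheory.Limits
open Literature.RepresentationTheory.FiniteGroups

namespace Literature.AlgebraicGeometry.Motives

namespace AbelianVariety

/-! ## §1 A central element `z` of prime order `p`: `H⟨z⟩ = ⋃_{k<p} Hz^k`, `m_{H⟨z⟩}(g) = Σ_{k<p} m_H(z^kg)`,
`p·(1_{H⟨z⟩})^G(g) = Σ_{k<p} (1_H)^G(z^k g)`, and the criterion -/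

section CentralPrime

variable {G : Type} [Group G] {H H' : Subgroup G} {z : G} {p : ℕ}

/-- `⟨z⟩ ⊴ G` for a central `z`. [folklore] -/
private theorem normal_zpowers_of_mem_center' (hz : z ∈ Subgroup.center G) : (Subgroup.zpowers z).Normal := by
  refine ⟨fun a ha g ↦ ?_⟩
  obtain ⟨k, rfl⟩ := Subgroup.mem_zpowers_iff.1 ha
  have hc : Commute g z := Subgroup.mem_center_iff.1 hz g
  rw [(hc.zpow_right k).eq, mul_inv_cancel_right]
  exact Subgroup.zpow_mem _ (Subgroup.mem_zpowers z) k

/-- `|T ⊔ N| = |T| · |N|` for `N ⊴ G` and `T ∩ N = 1`. [folklore] -/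
private theorem card_sup_eq_mul_of_normal_of_inf_eq_bot' (T N : Subgroup G) [N.Normal] (h : T ⊓ N = ⊥) :
    Nat.card (T ⊔ N : Subgroup G) = Nat.card T * Nat.card N := by
  have hrel : N.relIndex (T ⊔ N) = Nat.card T := by
    rw [Subgroup.relIndex_sup_right, ← Subgroup.inf_relIndex_right, inf_comm, h, Subgroup.relIndex_bot_left]
  have h2 := Subgroup.relIndex_mul_relIndex (⊥ : Subgroup G) N (T ⊔ N) bot_le le_sup_right
  rw [Subgroup.relIndex_bot_left, Subgroup.relIndex_bot_left, hrel] at h2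
  rw [← h2, mul_comm]

omit [Group G] in
/-- `|{x : P x}|` as the cardinality of a filter. [folklore] -/
private theorem natCard_subtype_eq_card_filter' [Fintype G] (P : G → Prop) [DecidablePred P] :
    Nat.card {x : G // P x} = (Finset.univ.filter P).card := by
  rw [← Fintype.card_subtype, ← Nat.card_eq_fintype_card]

/-- **`z^m ∈ H ↔ p ∣ m`** for `z` of prime order `p` with `z ∉ H` (if `p ∤ m`, some power of `z^m` is `z`).
[folklore] [cite: BartelDokchitser2015, Theorem B (3) ("H, H' ≤ G meet C trivially")] -/
theorem pow_mem_iff_dvd_of_not_mem (hp : p.Prime) (hzp : orderOf z = p) (hzH : z ∉ H) (m : ℕ) :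
    z ^ m ∈ H ↔ p ∣ m := by
  constructor
  · intro hm
    by_contra hdvd
    have hcop : m.Coprime (orderOf z) := by
      rw [hzp]
      exact (Nat.coprime_comm.1 ((Nat.Prime.coprime_iff_not_dvd hp).2 hdvd))
    obtain ⟨k, hk⟩ := exists_pow_eq_self_of_coprime hcop
    exact hzH (hk ▸ Subgroup.pow_mem _ hm k)
  · rintro ⟨c, rfl⟩
    rw [pow_mul, ← hzp, pow_orderOf_eq_one, one_pow]
    exact Subgroup.one_mem _

/-- **`H ∩ ⟨z⟩ = 1`** for `z` of prime order outside `H`. [folklore] [cite: BartelDokchitser2015, Theorem B (3)] -/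
theorem inf_zpowers_eq_bot_of_prime [Finite G] (hp : p.Prime) (hzp : orderOf z = p) (hzH : z ∉ H) :
    H ⊓ Subgroup.zpowers z = ⊥ := by
  classical
  haveI := Fintype.ofFinite G
  refine (Subgroup.eq_bot_iff_forall _).2 fun x hx ↦ ?_
  obtain ⟨hxH, hxz⟩ := Subgroup.mem_inf.1 hx
  rw [mem_zpowers_iff_mem_range_orderOf, Finset.mem_image] at hxz
  obtain ⟨m, -, rfl⟩ := hxz
  obtain ⟨c, rfl⟩ := (pow_mem_iff_dvd_of_not_mem hp hzp hzH m).1 hxH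
  rw [pow_mul, ← hzp, pow_orderOf_eq_one, one_pow]

/-- **`x ∈ H⟨z⟩ ↔ ∃ k < p, xz^k ∈ H`** (`z` central of prime order `p`): `H⟨z⟩ = ⋃_{k<p} Hz^{−k}`.
[folklore] [cite: BartelDokchitser2015, §5 Theorem 4 (2) ("IZ", "JZ")] -/
theorem mem_sup_zpowers_iff_exists_lt [Finite G] (hz : z ∈ Subgroup.center G) (hp : p.Prime) (hzp : orderOf z = p)
    (x : G) : x ∈ H ⊔ Subgroup.zpowers z ↔ ∃ k < p, x * z ^ k ∈ H := by
  classical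
  haveI := Fintype.ofFinite G
  haveI := normal_zpowers_of_mem_center' hz
  rw [Subgroup.mem_sup_of_normal_right]
  constructor
  · rintro ⟨y, hy, w, hw, rfl⟩
    rw [mem_zpowers_iff_mem_range_orderOf, hzp, Finset.mem_image] at hw
    obtain ⟨j, hj, rfl⟩ := hw
    rw [Finset.mem_range] at hj
    refine ⟨(p - j) % p, Nat.mod_lt _ hp.pos, ?_⟩
    have e : z ^ j * z ^ ((p - j) % p) = 1 := by
      by_cases hj0 : j = 0
      · subst hj0
        rw [pow_zero, one_mul, Nat.sub_zero, Nat.mod_self, pow_zero]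
      · rw [Nat.mod_eq_of_lt (Nat.sub_lt hp.pos (Nat.pos_of_ne_zero hj0)), ← pow_add, Nat.add_sub_cancel' hj.le,
          ← hzp, pow_orderOf_eq_one]
    rwa [mul_assoc, e, mul_one]
  · rintro ⟨k, -, hk⟩
    exact ⟨x * z ^ k, hk, (z ^ k)⁻¹, Subgroup.inv_mem _ (Subgroup.pow_mem _ (Subgroup.mem_zpowers z) k),
      by rw [mul_inv_cancel_right]⟩

/-- **`|H⟨z⟩| = p·|H|`** (`z` central of prime order `p`, `z ∉ H`). [folklore] [cite: BartelDokchitser2015, §5 Theorem 4 (2)] -/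
theorem card_sup_zpowers_of_prime [Finite G] (hz : z ∈ Subgroup.center G) (hp : p.Prime) (hzp : orderOf z = p)
    (hzH : z ∉ H) : Nat.card (H ⊔ Subgroup.zpowers z : Subgroup G) = p * Nat.card H := by
  haveI := normal_zpowers_of_mem_center' hz
  rw [card_sup_eq_mul_of_normal_of_inf_eq_bot' H _ (inf_zpowers_eq_bot_of_prime hp hzp hzH), Nat.card_zpowers, hzp,
    mul_comm]

/-- `x⁻¹gx · z^k = x⁻¹(z^k g)x` for a central `z`. [folklore] -/
private theorem conj_mul_pow_eq_conj_pow_mul (hz : z ∈ Subgroup.center G) (g x : G) (k : ℕ) :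
    x⁻¹ * g * x * z ^ k = x⁻¹ * (z ^ k * g) * x := by
  have hzc : ∀ y : G, y * z ^ k = z ^ k * y := fun y ↦
    Subgroup.mem_center_iff.1 (Subgroup.pow_mem _ hz k) y
  calc x⁻¹ * g * x * z ^ k = x⁻¹ * g * (x * z ^ k) := by rw [mul_assoc]
    _ = x⁻¹ * g * (z ^ k * x) := by rw [hzc x]
    _ = x⁻¹ * (g * z ^ k) * x := by simp only [mul_assoc]
    _ = x⁻¹ * (z ^ k * g) * x := by rw [hzc g]

/-- **The marks of `H⟨z⟩` for a central `z` of prime order `p` outside `H`: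
`m_{H⟨z⟩}(g) = Σ_{k<p} m_H(z^k g)`** (a conjugate `x⁻¹gx` lies in `⋃_k Hz^{−k}`, in exactly one of them).
[folklore] [cite: BartelDokchitser2015, §1.1 ("Θ ∈ K(G) ⟺ Σ_i n_i Ind 1_{H_i} = 0"); §5 Theorem 4 (2)] -/
theorem card_conj_mem_sup_zpowers_eq_sum [Fintype G] (hz : z ∈ Subgroup.center G) (hp : p.Prime)
    (hzp : orderOf z = p) (hzH : z ∉ H) (g : G) :
    Nat.card {x : G // x⁻¹ * g * x ∈ H ⊔ Subgroup.zpowers z} =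
      ∑ k ∈ Finset.range p, Nat.card {x : G // x⁻¹ * (z ^ k * g) * x ∈ H} := by
  classical
  rw [natCard_subtype_eq_card_filter' (fun x : G ↦ x⁻¹ * g * x ∈ H ⊔ Subgroup.zpowers z)]
  have hfilter : (Finset.univ.filter fun x : G ↦ x⁻¹ * g * x ∈ H ⊔ Subgroup.zpowers z) =
      (Finset.range p).biUnion fun k ↦ Finset.univ.filter fun x : G ↦ x⁻¹ * (z ^ k * g) * x ∈ H := by
    ext x
    simp only [Finset.mem_filter, Finset.mem_univ, true_and, Finset.mem_biUnion, Finset.mem_range]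
    rw [mem_sup_zpowers_iff_exists_lt hz hp hzp]
    simp only [conj_mul_pow_eq_conj_pow_mul hz g x]
  rw [hfilter, Finset.card_biUnion]
  · exact Finset.sum_congr rfl fun k _ ↦ (natCard_subtype_eq_card_filter' _).symm
  · intro k hk l hl hkl
    refine Finset.disjoint_filter.2 fun x _ h1 h2 ↦ hkl ?_
    rw [Finset.mem_coe, Finset.mem_range] at hk hl
    rw [← conj_mul_pow_eq_conj_pow_mul hz g x] at h1 h2
    -- coset bookkeeping: `(x⁻¹gx z^k)⁻¹ (x⁻¹gx z^l) = z^{l−k} ∈ H` is a power of `z`, so `p ∣ l − k`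
    have aux : ∀ {k l : ℕ}, l < p → k ≤ l → x⁻¹ * g * x * z ^ k ∈ H → x⁻¹ * g * x * z ^ l ∈ H → k = l := by
      intro k l hl hle h1 h2
      obtain ⟨d, rfl⟩ := Nat.exists_eq_add_of_le hle
      have hmem : z ^ d ∈ H := by
        have h := H.mul_mem (H.inv_mem h1) h2
        rwa [pow_add, ← mul_assoc (x⁻¹ * g * x) (z ^ k) (z ^ d), inv_mul_cancel_left] at h
      have hd : d = 0 := Nat.eq_zero_of_dvd_of_lt ((pow_mem_iff_dvd_of_not_mem hp hzp hzH d).1 hmem) (by omega)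
      rw [hd, add_zero]
    rcases le_total k l with hle | hle
    · exact aux hl hle h1 h2
    · exact (aux hk hle h2 h1).symm

/-- **`p · (1_{H⟨z⟩})^G(g) = Σ_{k<p} (1_H)^G(z^k g)`**: the permutation character of `G/HZ` is the average of that of
`G/H` over the `Z`-translates (`z` central of prime order `p`, `z ∉ H`). [folklore] [cite: BartelDokchitser2015, §5 Theorem 4 (2); §7 proof of Prop. 8 ("⟨ρ, Ind_H^G 1⟩ = ⟨ρ, Ind_{HC_l}^G 1⟩")] -/
theorem prime_mul_indClassFun_sup_zpowers_one_apply [Fintype G] (hz : z ∈ Subgroup.center G) (hp : p.Prime)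
    (hzp : orderOf z = p) (hzH : z ∉ H) (g : G) :
    (p : ℂ) * indClassFun (H ⊔ Subgroup.zpowers z) (1 : ↥(H ⊔ Subgroup.zpowers z) → ℂ) g =
      ∑ k ∈ Finset.range p, indClassFun H (1 : H → ℂ) (z ^ k * g) := by
  rw [indClassFun_one_apply_eq_div, card_conj_mem_sup_zpowers_eq_sum hz hp hzp hzH,
    card_sup_zpowers_of_prime hz hp hzp hzH]
  simp only [indClassFun_one_apply_eq_div]
  have hH : (Nat.card H : ℂ) ≠ 0 := Nat.cast_ne_zero.2 Nat.card_pos.ne'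
  have hp0 : (p : ℂ) ≠ 0 := Nat.cast_ne_zero.2 hp.ne_zero
  rw [← Finset.sum_div]
  push_cast
  field_simp

/-- **The criterion**: if `D = (1_H)^G − (1_{H'})^G` is invariant under `g ↦ zg` (`z` central of prime order outside
`H` and `H'`), then `(1_H)^G + (1_{H'⟨z⟩})^G = (1_{H'})^G + (1_{H⟨z⟩})^G`: `Θ = H − H' + H'Z − HZ` is a Brauer relation.
[folklore] [cite: BartelDokchitser2015, §5 Theorem 4 (2); Theorem B (3) ("Conversely, all Θ … are Brauer relations")] -/
theorem indClassFun_add_indClassFun_sup_zpowers_eq_of_forall_prime [Fintype G] (hz : z ∈ Subgroup.center G)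
    (hp : p.Prime) (hzp : orderOf z = p) (hzH : z ∉ H) (hzH' : z ∉ H')
    (hD : ∀ g : G, indClassFun H (1 : H → ℂ) (z * g) - indClassFun H' (1 : H' → ℂ) (z * g) =
      indClassFun H (1 : H → ℂ) g - indClassFun H' (1 : H' → ℂ) g) :
    indClassFun H (1 : H → ℂ) + indClassFun (H' ⊔ Subgroup.zpowers z) (1 : ↥(H' ⊔ Subgroup.zpowers z) → ℂ) =
      indClassFun H' (1 : H' → ℂ) + indClassFun (H ⊔ Subgroup.zpowers z) (1 : ↥(H ⊔ Subgroup.zpowers z) → ℂ) := by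
  have hDk : ∀ (k : ℕ) (g : G), indClassFun H (1 : H → ℂ) (z ^ k * g) - indClassFun H' (1 : H' → ℂ) (z ^ k * g) =
      indClassFun H (1 : H → ℂ) g - indClassFun H' (1 : H' → ℂ) g := by
    intro k
    induction k with
    | zero => intro g; rw [pow_zero, one_mul]
    | succ k ih => intro g; rw [pow_succ', mul_assoc, hD, ih]
  have hp0 : (p : ℂ) ≠ 0 := Nat.cast_ne_zero.2 hp.ne_zero
  funext g
  simp only [Pi.add_apply]
  have h1 := prime_mul_indClassFun_sup_zpowers_one_apply hz hp hzp hzH g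
  have h2 := prime_mul_indClassFun_sup_zpowers_one_apply hz hp hzp hzH' g
  have hsum : ∑ k ∈ Finset.range p, indClassFun H (1 : H → ℂ) (z ^ k * g) -
      ∑ k ∈ Finset.range p, indClassFun H' (1 : H' → ℂ) (z ^ k * g) =
      (p : ℂ) * (indClassFun H (1 : H → ℂ) g - indClassFun H' (1 : H' → ℂ) g) := by
    rw [← Finset.sum_sub_distrib, Finset.sum_congr rfl fun k _ ↦ hDk k g, Finset.sum_const, Finset.card_range,
      nsmul_eq_mul]
  apply mul_left_cancel₀ hp0
  linear_combination h2 - h1 - hsum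

end CentralPrime

/-! ## §2 The mechanism: `|H| = |H'|`, `z ∉ H, H'`, and every `g ∉ ⟨z⟩` conjugate to `zg` -/

section ConjugateToTranslate

variable {G : Type} [Group G] {H H' : Subgroup G} {z : G} {p : ℕ}

/-- **Off the identity, the permutation character of `G/H` vanishes on `⟨z⟩`**: `(1_H)^G(ζ) = 0` for
`1 ≠ ζ ∈ ⟨z⟩`, `z` central of prime order outside `H` (`⟨z⟩ ∩ H = 1` and central elements are their own conjugates);
at `ζ = 1` it is `[G:H]` (`card_conj_mem_one_eq`). [folklore] [cite: BartelDokchitser2015, Theorem B (3) ("|H| = |H'|", "meet C trivially")] -/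
theorem indClassFun_one_apply_eq_zero_of_mem_zpowers_center [Fintype G] (hz : z ∈ Subgroup.center G) (hp : p.Prime)
    (hzp : orderOf z = p) (hzH : z ∉ H) {ζ : G} (hζ : ζ ∈ Subgroup.zpowers z) (h1 : ζ ≠ 1) :
    indClassFun H (1 : H → ℂ) ζ = 0 := by
  have hζH : ζ ∉ H := fun h ↦ h1
    ((Subgroup.eq_bot_iff_forall _).1 (inf_zpowers_eq_bot_of_prime hp hzp hzH) ζ (Subgroup.mem_inf.2 ⟨h, hζ⟩))
  have hζc : ζ ∈ Subgroup.center G := (Subgroup.zpowers_le.2 hz : Subgroup.zpowers z ≤ Subgroup.center G) hζ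
  rw [indClassFun_one_apply_eq_div, card_conj_mem_eq_zero_of_mem_center hζc hζH, Nat.cast_zero, zero_div]

/-- **On `⟨z⟩`, `D = (1_H)^G − (1_{H'})^G` vanishes when `|H| = |H'|`** (both are `[G:H]δ_1` there).
[folklore] [cite: BartelDokchitser2015, Theorem B (3) ("|H| = |H'|")] -/
theorem indClassFun_sub_apply_eq_zero_of_mem_zpowers_center [Fintype G] (hz : z ∈ Subgroup.center G)
    (hp : p.Prime) (hzp : orderOf z = p) (hcard : Nat.card H = Nat.card H') (hzH : z ∉ H) (hzH' : z ∉ H') {ζ : G}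
    (hζ : ζ ∈ Subgroup.zpowers z) : indClassFun H (1 : H → ℂ) ζ - indClassFun H' (1 : H' → ℂ) ζ = 0 := by
  by_cases h1 : ζ = 1
  · subst h1
    rw [indClassFun_one_apply_eq_div, indClassFun_one_apply_eq_div, card_conj_mem_one_eq, card_conj_mem_one_eq, hcard,
      sub_self]
  · rw [indClassFun_one_apply_eq_zero_of_mem_zpowers_center hz hp hzp hzH hζ h1,
      indClassFun_one_apply_eq_zero_of_mem_zpowers_center hz hp hzp hzH' hζ h1, sub_self]

/-- **THE MECHANISM.** `z` central of prime order `p`; `H, H'` subgroups of the same order not containing `z`; every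
`g ∉ ⟨z⟩` conjugate to `zg`.  Then `(1_H)^G + (1_{H'⟨z⟩})^G = (1_{H'})^G + (1_{H⟨z⟩})^G`, i.e.
**`Θ = H − HZ − H' + H'Z` is a Brauer relation** (`Z = ⟨z⟩`): off `⟨z⟩` each permutation character is a class
function, hence `z`-invariant; on `⟨z⟩` both are `[G:H]δ_1`.
[cite: BartelDokchitser2015, §5 Theorem 4 (2) ("the relation is I − IZ − J + JZ"); Theorem B (3)] -/
theorem indClassFun_add_indClassFun_sup_zpowers_eq_of_conj_mul [Fintype G] (hz : z ∈ Subgroup.center G)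
    (hp : p.Prime) (hzp : orderOf z = p) (hcard : Nat.card H = Nat.card H') (hzH : z ∉ H) (hzH' : z ∉ H')
    (hconj : ∀ g : G, g ∉ Subgroup.zpowers z → ∃ y : G, y * g * y⁻¹ = z * g) :
    indClassFun H (1 : H → ℂ) + indClassFun (H' ⊔ Subgroup.zpowers z) (1 : ↥(H' ⊔ Subgroup.zpowers z) → ℂ) =
      indClassFun H' (1 : H' → ℂ) + indClassFun (H ⊔ Subgroup.zpowers z) (1 : ↥(H ⊔ Subgroup.zpowers z) → ℂ) := by
  refine indClassFun_add_indClassFun_sup_zpowers_eq_of_forall_prime hz hp hzp hzH hzH' fun g ↦ ?_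
  by_cases hg : g ∈ Subgroup.zpowers z
  · -- on `⟨z⟩`: both differences vanish
    rw [indClassFun_sub_apply_eq_zero_of_mem_zpowers_center hz hp hzp hcard hzH hzH'
        (Subgroup.mul_mem _ (Subgroup.mem_zpowers z) hg),
      indClassFun_sub_apply_eq_zero_of_mem_zpowers_center hz hp hzp hcard hzH hzH' hg]
  · -- off `⟨z⟩`: `zg = ygy⁻¹`, and marks are class functions
    obtain ⟨y, hy⟩ := hconj g hg
    simp only [indClassFun_one_apply_eq_div]
    rw [← hy, ← card_conj_mem_eq_of_zpowers_conj_eq H (g := g) (x := y) rfl,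
      ← card_conj_mem_eq_of_zpowers_conj_eq H' (g := g) (x := y) rfl]

end ConjugateToTranslate

/-! ## §3 Non-abelian groups of order `p³`: `Z(G) = ⟨z⟩ ≅ C_p`, the class of a non-central `g` is `gZ(G)`, and
Theorem A Case 2 / Theorem 4 (2) -/

section PCubed

variable {G : Type} [Group G] [Fintype G] {p : ℕ} [hp : Fact p.Prime]

/-- **`Z(G) = ⟨z⟩` for every central `z ≠ 1`** in a non-abelian group of order `p³` (`|Z(G)| = p`; tree
`PCubed.card_center`). [cite: JamesLiebeck2001, Ch. 26 p. 301 ("Z = ⟨z⟩ ≅ C_p")] [cite: BartelDokchitser2015, §1.1 Theorem A Case 2 ("z ∈ Z(G)")] -/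
theorem center_eq_zpowers_of_card_eq_prime_cube (hG : Nat.card G = p ^ 3) (hna : ∃ a b : G, a * b ≠ b * a) {z : G}
    (hz : z ∈ Subgroup.center G) (hz1 : z ≠ 1) : Subgroup.center G = Subgroup.zpowers z := by
  have hZ := PCubed.card_center hG hna
  have hle : Subgroup.zpowers z ≤ Subgroup.center G := (Subgroup.zpowers_le).2 hz
  have hdvd : Nat.card (Subgroup.zpowers z) ∣ p := hZ ▸ Subgroup.card_dvd_of_le hle
  rcases (Nat.dvd_prime hp.out).1 hdvd with h | h
  · exfalso
    rw [Nat.card_zpowers, orderOf_eq_one_iff] at h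
    exact hz1 h
  · exact (Subgroup.eq_of_le_of_card_ge hle (by rw [h, hZ])).symm

/-- A central `z ≠ 1` of a non-abelian group of order `p³` has order `p`. [cite: JamesLiebeck2001, Ch. 26 p. 301] -/
theorem orderOf_eq_of_mem_center_of_card_eq_prime_cube (hG : Nat.card G = p ^ 3) (hna : ∃ a b : G, a * b ≠ b * a)
    {z : G} (hz : z ∈ Subgroup.center G) (hz1 : z ≠ 1) : orderOf z = p := by
  rw [← Nat.card_zpowers, ← center_eq_zpowers_of_card_eq_prime_cube hG hna hz hz1, PCubed.card_center hG hna]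

/-- **The class of a non-central element is its whole `Z(G)`-coset**: for `g ∉ Z(G)` and `z ∈ Z(G)` there is `y`
with `ygy⁻¹ = zg` (the homomorphism `y ↦ [g, y]` — Dornhoff's `φ_g`, tree `Extraspecial.exists_hom_commutator` — maps
onto the subgroup `Z(G)` of prime order, so `[g, y] = z⁻¹` for some `y`, and `ygy⁻¹ = [y, g]g = zg`).
[cite: Dornhoff1971, proof of Lemma 31.4 ("φ_x is onto P'")] [cite: BartelDokchitser2015, §5 proof of Theorem 4] -/
theorem exists_conj_eq_mul_of_not_mem_center (hG : Nat.card G = p ^ 3) (hna : ∃ a b : G, a * b ≠ b * a) {g z : G}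
    (hg : g ∉ Subgroup.center G) (hz : z ∈ Subgroup.center G) : ∃ y : G, y * g * y⁻¹ = z * g := by
  have hc := PCubed.commutator_le_center hG hna
  have hZ := PCubed.card_center hG hna
  obtain ⟨φ, hφ⟩ := Extraspecial.exists_hom_commutator hc g
  have hle : φ.range ≤ Subgroup.center G := by
    rintro _ ⟨y, rfl⟩
    rw [hφ]
    exact hc (by
      rw [commutator_def]
      exact Subgroup.commutator_mem_commutator (Subgroup.mem_top g) (Subgroup.mem_top y))
  have hne : φ.range ≠ ⊥ := by
    intro h
    apply hg
    rw [Subgroup.mem_center_iff]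
    intro y
    have hy : φ y ∈ φ.range := ⟨y, rfl⟩
    rw [h, Subgroup.mem_bot, hφ, commutatorElement_eq_one_iff_mul_comm] at hy
    exact hy.symm
  have hrange : φ.range = Subgroup.center G := by
    have hdvd : Nat.card φ.range ∣ p := hZ ▸ Subgroup.card_dvd_of_le hle
    rcases (Nat.dvd_prime hp.out).1 hdvd with h1 | h
    · exact absurd (Subgroup.eq_bot_of_card_eq φ.range h1) hne
    · exact Subgroup.eq_of_le_of_card_ge hle (by rw [h, hZ])
  obtain ⟨y, hy⟩ : z⁻¹ ∈ φ.range := hrange ▸ Subgroup.inv_mem _ hz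
  refine ⟨y, ?_⟩
  rw [hφ] at hy
  calc y * g * y⁻¹ = ⁅y, g⁆ * g := by simp only [commutatorElement_def]; group
    _ = (⁅g, y⁆)⁻¹ * g := by rw [commutatorElement_inv]
    _ = z * g := by rw [hy, inv_inv]

omit [Fintype G] hp in
/-- If `Z(G) = ⟨z⟩` has order `p = |I|` and `I ≰ Z(G)`, then `z ∉ I` (else `Z(G) ≤ I`, of the same order). [folklore]
[cite: BartelDokchitser2015, §5 Theorem 4 (2) ("non-central subgroups of order p")] -/
theorem not_mem_of_card_eq_prime_of_not_le_center [Finite G] {I : Subgroup G} {z : G}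
    (hZ : Subgroup.center G = Subgroup.zpowers z) (hZp : Nat.card (Subgroup.center G) = p) (hI : Nat.card I = p)
    (hIZ : ¬ I ≤ Subgroup.center G) : z ∉ I := by
  intro hzI
  apply hIZ
  have hle : Subgroup.center G ≤ I := by rw [hZ]; exact (Subgroup.zpowers_le).2 hzI
  rw [Subgroup.eq_of_le_of_card_ge hle (by rw [hI, hZp])]

/-- **BARTEL–DOKCHITSER'S THEOREM A, CASE 2 / TORNEHAVE–BOUC'S HEISENBERG RELATION.**  Let `G` be a non-abelian group
of order `p³` (`p` prime) and `I, J ≤ G` subgroups of order `p` not contained in the centre.  Then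
`(1_I)^G + (1_{J Z(G)})^G = (1_J)^G + (1_{I Z(G)})^G`: **`Θ = I − IZ − J + JZ`, `Z = Z(G)`, is a Brauer relation.**
[cite: BartelDokchitser2015, §1.1 Theorem A Case 2; §5 Theorem 4 (Tornehave–Bouc) (2); Theorem B (3)] -/
theorem indClassFun_add_indClassFun_sup_center_eq_of_card_eq_prime_cube (hG : Nat.card G = p ^ 3)
    (hna : ∃ a b : G, a * b ≠ b * a) {I J : Subgroup G} (hI : Nat.card I = p) (hJ : Nat.card J = p)
    (hIZ : ¬ I ≤ Subgroup.center G) (hJZ : ¬ J ≤ Subgroup.center G) :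
    indClassFun I (1 : I → ℂ) + indClassFun (J ⊔ Subgroup.center G) (1 : ↥(J ⊔ Subgroup.center G) → ℂ) =
      indClassFun J (1 : J → ℂ) + indClassFun (I ⊔ Subgroup.center G) (1 : ↥(I ⊔ Subgroup.center G) → ℂ) := by
  have hZ := PCubed.card_center hG hna
  -- a generator of the centre
  obtain ⟨⟨z, hz⟩, hz1⟩ := Subgroup.ne_bot_iff_exists_ne_one.1
    ((Subgroup.one_lt_card_iff_ne_bot _).1 (by rw [hZ]; exact hp.out.one_lt))
  have hz1 : z ≠ 1 := fun h ↦ hz1 (Subtype.ext (by exact h))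
  have hZz := center_eq_zpowers_of_card_eq_prime_cube hG hna hz hz1
  have hzp := orderOf_eq_of_mem_center_of_card_eq_prime_cube hG hna hz hz1
  have hzI := not_mem_of_card_eq_prime_of_not_le_center hZz hZ hI hIZ
  have hzJ := not_mem_of_card_eq_prime_of_not_le_center hZz hZ hJ hJZ
  rw [hZz]
  exact indClassFun_add_indClassFun_sup_zpowers_eq_of_conj_mul hz hp.out hzp (hI.trans hJ.symm) hzI hzJ
    fun g hg ↦ exists_conj_eq_mul_of_not_mem_center hG hna (hZz ▸ hg) hz

/-- The signed form over `![I, J, I Z(G), J Z(G)]` with `Θ = ![1, −1, −1, 1]`: `Σ_i Θ_i (1_{H_i})^G = 0`.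
[cite: BartelDokchitser2015, §1.1 ("Θ ∈ K(G) ⟺ Σ_i n_i Ind 1_{H_i} = 0"), Theorem A Case 2; §5 Theorem 4 (2)] -/
theorem sum_theta_smul_indClassFun_pCubed_eq_zero (hG : Nat.card G = p ^ 3) (hna : ∃ a b : G, a * b ≠ b * a)
    {I J : Subgroup G} (hI : Nat.card I = p) (hJ : Nat.card J = p) (hIZ : ¬ I ≤ Subgroup.center G)
    (hJZ : ¬ J ≤ Subgroup.center G) :
    ∑ i : Fin 4, ((![1, -1, -1, 1] : Fin 4 → ℤ) i : ℂ) •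
      indClassFun ((![I, J, I ⊔ Subgroup.center G, J ⊔ Subgroup.center G] : Fin 4 → Subgroup G) i) 1 = 0 := by
  rw [Fin.sum_univ_four]
  show ((1 : ℤ) : ℂ) • indClassFun I 1 + ((-1 : ℤ) : ℂ) • indClassFun J 1 +
      ((-1 : ℤ) : ℂ) • indClassFun (I ⊔ Subgroup.center G) 1 + ((1 : ℤ) : ℂ) • indClassFun (J ⊔ Subgroup.center G) 1 = 0
  funext g
  have hg := congr_fun (indClassFun_add_indClassFun_sup_center_eq_of_card_eq_prime_cube hG hna hI hJ hIZ hJZ) g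
  simp only [Pi.add_apply, Pi.smul_apply, smul_eq_mul, Pi.zero_apply] at hg ⊢
  push_cast
  linear_combination hg

end PCubed

/-! ## §4 The Heisenberg group of order `p³` (`p` odd): Bartel–Dokchitser's generators
`Θ_j = ⟨y⟩ − ⟨x_j⟩ − ⟨y⟩Z + ⟨x_j⟩Z`, `y = (0,1,0)`, `x_j = (1,j,0)` — of order `p`, non-central, pairwise non-conjugate -/

section Heisenberg

open Literature.Computability.AlgebraicComplexity

variable {p : ℕ} [hp : Fact p.Prime]

/-- Powers of `y = (0, 1, 0)`: `yⁿ = (0, n, 0)` (from the law `(x,y,α)(u,v,β) = (x+u, y+v, α+β+2uy)`).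
[cite: CohnUmans2003, §7.1 (group law before Prop. 7.1)] [cite: BartelDokchitser2015, §1.1 Theorem A Case 2 ("⟨y⟩")] -/
theorem heis_y_pow (n : ℕ) :
    (⟨0, 1, 0⟩ : Heis (LinearMap.mul (ZMod p) (ZMod p))) ^ n = ⟨0, (n : ZMod p), 0⟩ := by
  induction n with
  | zero => rw [pow_zero]; ext <;> simp [Heis.one_x, Heis.one_y, Heis.one_a]
  | succ n ih =>
    rw [pow_succ, ih]
    ext
    · simp
    · simp
    · simp

/-- Powers of `x_j = (1, j, 0)`: `x_jⁿ = (n, nj, (n² − n)j)` (from the law `(x,y,α)(u,v,β) = (x+u, y+v, α+β+2uy)`).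
[cite: CohnUmans2003, §7.1 (group law before Prop. 7.1)] [cite: BartelDokchitser2015, §1.1 Theorem A Case 2 ("⟨xy^j⟩")] -/
theorem heis_xj_pow (j : ZMod p) (n : ℕ) :
    (⟨1, j, 0⟩ : Heis (LinearMap.mul (ZMod p) (ZMod p))) ^ n = ⟨(n : ZMod p), n * j, (n * n - n) * j⟩ := by
  induction n with
  | zero => rw [pow_zero]; ext <;> simp [Heis.one_x, Heis.one_y, Heis.one_a]
  | succ n ih =>
    rw [pow_succ, ih]
    ext
    · simp
    · simp; ring
    · simp; ring

/-- **`y = (0,1,0)` has order `p`.** [cite: BartelDokchitser2015, §1.1 Theorem A Case 2 ("⟨y⟩")] -/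
theorem orderOf_heis_y : orderOf (⟨0, 1, 0⟩ : Heis (LinearMap.mul (ZMod p) (ZMod p))) = p := by
  refine orderOf_eq_prime ?_ ?_
  · rw [heis_y_pow]; ext <;> simp
  · intro h
    have := congrArg Heis.y h
    simp at this

/-- **`x_j = (1,j,0)` has order `p`.** [cite: BartelDokchitser2015, §1.1 Theorem A Case 2 ("⟨xy^j⟩")] -/
theorem orderOf_heis_xj (j : ZMod p) : orderOf (⟨1, j, 0⟩ : Heis (LinearMap.mul (ZMod p) (ZMod p))) = p := by
  refine orderOf_eq_prime ?_ ?_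
  · rw [heis_xj_pow]; ext <;> simp
  · intro h
    have := congrArg Heis.x h
    simp at this

/-- `(2 : ZMod p) ≠ 0` for an odd prime `p`. [folklore] -/
private theorem two_ne_zero_zmod (hp2 : p ≠ 2) : (2 : ZMod p) ≠ 0 := by
  intro h
  have h2 : ((2 : ℕ) : ZMod p) = 0 := by exact_mod_cast h
  rw [ZMod.natCast_eq_zero_iff] at h2
  exact hp2 ((Nat.prime_dvd_prime_iff_eq hp.out Nat.prime_two).1 h2)

/-- **`⟨y⟩` is non-central** (`p` odd: `y` and `(1,0,0)` do not commute). [cite: BartelDokchitser2015, §1.1 Theorem A Case 2; §5 Theorem 4 (2) ("non-central")] -/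
theorem zpowers_heis_y_not_le_center (hp2 : p ≠ 2) :
    ¬ Subgroup.zpowers (⟨0, 1, 0⟩ : Heis (LinearMap.mul (ZMod p) (ZMod p))) ≤
      Subgroup.center (Heis (LinearMap.mul (ZMod p) (ZMod p))) := by
  intro h
  have hc := Subgroup.mem_center_iff.1 (h (Subgroup.mem_zpowers _)) ⟨1, 0, 0⟩
  have := congrArg Heis.a hc
  simp at this
  exact two_ne_zero_zmod hp2 this.symm

/-- **`⟨x_j⟩` is non-central** (`x_j` and `y` do not commute). [cite: BartelDokchitser2015, §1.1 Theorem A Case 2; §5 Theorem 4 (2)] -/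
theorem zpowers_heis_xj_not_le_center (hp2 : p ≠ 2) (j : ZMod p) :
    ¬ Subgroup.zpowers (⟨1, j, 0⟩ : Heis (LinearMap.mul (ZMod p) (ZMod p))) ≤
      Subgroup.center (Heis (LinearMap.mul (ZMod p) (ZMod p))) := by
  intro h
  have hc := Subgroup.mem_center_iff.1 (h (Subgroup.mem_zpowers _)) ⟨0, 1, 0⟩
  have := congrArg Heis.a hc
  simp at this
  exact two_ne_zero_zmod hp2 this

/-- Conjugation preserves the `x`- and `y`-coordinates. [folklore] -/
private theorem heis_conj_x_y (g h : Heis (LinearMap.mul (ZMod p) (ZMod p))) :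
    (g * h * g⁻¹).x = h.x ∧ (g * h * g⁻¹).y = h.y := by
  constructor <;> simp

/-- **`⟨x_j⟩` is not conjugate to `⟨y⟩`** (conjugation preserves the `x`-coordinate, `0` on `⟨y⟩`, `1` at `x_j`).
[cite: BartelDokchitser2015, §1.1 Theorem A Case 2; §5 Theorem 4 (2) ("two non-conjugate non-central subgroups of order p")] -/
theorem zpowers_heis_xj_ne_map_conj_zpowers_heis_y (j : ZMod p) (g : Heis (LinearMap.mul (ZMod p) (ZMod p))) :
    Subgroup.zpowers (⟨1, j, 0⟩ : Heis (LinearMap.mul (ZMod p) (ZMod p))) ≠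
      (Subgroup.zpowers (⟨0, 1, 0⟩ : Heis (LinearMap.mul (ZMod p) (ZMod p)))).map (MulAut.conj g).toMonoidHom := by
  intro h
  rw [zpowers_map_mulAut_conj] at h
  have hmem : (⟨1, j, 0⟩ : Heis (LinearMap.mul (ZMod p) (ZMod p))) ∈
      Subgroup.zpowers (g * ⟨0, 1, 0⟩ * g⁻¹) := h ▸ Subgroup.mem_zpowers _
  rw [mem_zpowers_iff_mem_range_orderOf, Finset.mem_image] at hmem
  obtain ⟨m, -, hm⟩ := hmem
  rw [conj_pow, heis_y_pow] at hm
  have hx := congrArg Heis.x hm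
  rw [(heis_conj_x_y g _).1] at hx
  exact zero_ne_one (α := ZMod p) hx

/-- **`⟨x_j⟩` and `⟨x_{j'}⟩` are not conjugate for `j ≠ j'`** (the `(x,y)`-shadow of `⟨x_j⟩` is the line `{(n, nj)}`):
together with `⟨y⟩`, `p + 1` pairwise non-conjugate non-central subgroups of order `p`.
[cite: BartelDokchitser2015, §1.1 Theorem A Case 2 ("Θ_j, 1 ≤ j ≤ p")] -/
theorem zpowers_heis_xj_ne_map_conj_zpowers_heis_xj {j j' : ZMod p} (hjj' : j ≠ j')
    (g : Heis (LinearMap.mul (ZMod p) (ZMod p))) :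
    Subgroup.zpowers (⟨1, j', 0⟩ : Heis (LinearMap.mul (ZMod p) (ZMod p))) ≠
      (Subgroup.zpowers (⟨1, j, 0⟩ : Heis (LinearMap.mul (ZMod p) (ZMod p)))).map (MulAut.conj g).toMonoidHom := by
  intro h
  rw [zpowers_map_mulAut_conj] at h
  have hmem : (⟨1, j', 0⟩ : Heis (LinearMap.mul (ZMod p) (ZMod p))) ∈
      Subgroup.zpowers (g * ⟨1, j, 0⟩ * g⁻¹) := h ▸ Subgroup.mem_zpowers _
  rw [mem_zpowers_iff_mem_range_orderOf, Finset.mem_image] at hmem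
  obtain ⟨m, -, hm⟩ := hmem
  rw [conj_pow, heis_xj_pow] at hm
  have hx := congrArg Heis.x hm
  have hy := congrArg Heis.y hm
  rw [(heis_conj_x_y g _).1] at hx
  rw [(heis_conj_x_y g _).2] at hy
  change (m : ZMod p) = 1 at hx
  change (m : ZMod p) * j = j' at hy
  rw [hx, one_mul] at hy
  exact hjj' hy

/-- **Bartel–Dokchitser's `Θ_j` are Brauer relations of the Heisenberg group of order `p³`** (`p` an odd prime): for
every `j ∈ ℤ/p`, `(1_{⟨y⟩})^G + (1_{⟨x_j⟩Z(G)})^G = (1_{⟨x_j⟩})^G + (1_{⟨y⟩Z(G)})^G` with `y = (0,1,0)`, `x_j = (1,j,0)`.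
[cite: BartelDokchitser2015, §1.1 Theorem A Case 2 ("Θ_j = ⟨y⟩ − ⟨xy^j⟩ − ⟨y,z⟩ + ⟨xy^j,z⟩"); §5 Theorem 4 (2)] -/
theorem indClassFun_heis_theta_j (hp2 : p ≠ 2) (j : ZMod p) :
    indClassFun (Subgroup.zpowers (⟨0, 1, 0⟩ : Heis (LinearMap.mul (ZMod p) (ZMod p)))) 1 +
        indClassFun (Subgroup.zpowers (⟨1, j, 0⟩ : Heis (LinearMap.mul (ZMod p) (ZMod p))) ⊔
          Subgroup.center (Heis (LinearMap.mul (ZMod p) (ZMod p)))) 1 =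
      indClassFun (Subgroup.zpowers (⟨1, j, 0⟩ : Heis (LinearMap.mul (ZMod p) (ZMod p)))) 1 +
        indClassFun (Subgroup.zpowers (⟨0, 1, 0⟩ : Heis (LinearMap.mul (ZMod p) (ZMod p))) ⊔
          Subgroup.center (Heis (LinearMap.mul (ZMod p) (ZMod p)))) 1 :=
  indClassFun_add_indClassFun_sup_center_eq_of_card_eq_prime_cube PCubed.natCard_heis_zmod
    (PCubed.heis_zmod_nonabelian hp2) (by rw [Nat.card_zpowers, orderOf_heis_y])
    (by rw [Nat.card_zpowers, orderOf_heis_xj]) (zpowers_heis_y_not_le_center hp2) (zpowers_heis_xj_not_le_center hp2 j)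

end Heisenberg

/-! ## §5 Kani–Rosen: `B_I × B_{J Z(G)} ∼ B_J × B_{I Z(G)}` for the action of a non-abelian group of order `p³` on an
abelian variety -/

section KaniRosen

variable {K : Type u} [Field K] {X : AbelianVariety K} {G : Type} [Group G] [Fintype G] [DecidableEq G]
  (ρ : G →* End X)

/-- From a two-plus-two identity of permutation characters to Hom counts. [cite: KaniRosen1989, Thm. 3] [cite: BartelDokchitser2015, §1.1] -/
private theorem finrank_hom_add_eq_of_indClassFun_add_eq' {A A' B₁ B₁' : Subgroup G} [Fintype A] [Fintype A']
    [Fintype B₁] [Fintype B₁'] {NA NA' NB NB' : X ⟶ X}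
    (h : indClassFun A (1 : A → ℂ) + indClassFun B₁' (1 : B₁' → ℂ) = indClassFun A' (1 : A' → ℂ) + indClassFun B₁ (1 : B₁ → ℂ))
    (hNA : End.of NA = ∑ x : A, ρ x) (hNA' : End.of NA' = ∑ x : A', ρ x) (hNB : End.of NB = ∑ x : B₁, ρ x)
    (hNB' : End.of NB' = ∑ x : B₁', ρ x) (B : AbelianVariety K) :
    Module.finrank ℤ (image NA ⟶ B) + Module.finrank ℤ (image NB' ⟶ B) =
      Module.finrank ℤ (image NA' ⟶ B) + Module.finrank ℤ (image NB ⟶ B) := by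
  classical
  have key := sum_mul_finrank_hom_eq_of_sum_smul_indClassFun_one_eq ρ (![A, B₁'] : Fin 2 → Subgroup G)
    (![A', B₁] : Fin 2 → Subgroup G) (N := ![NA, NB']) (N' := ![NA', NB]) (fun _ ↦ 1) (fun _ ↦ 1)
    (by
      simp only [Fin.sum_univ_two, Nat.cast_one, one_smul]
      convert h <;> rfl)
    (Fin.forall_fin_two.2 ⟨by convert hNA <;> rfl, by convert hNB' <;> rfl⟩)
    (Fin.forall_fin_two.2 ⟨by convert hNA' <;> rfl, by convert hNB <;> rfl⟩) B
  simp only [Fin.sum_univ_two, Matrix.cons_val_zero, Matrix.cons_val_one, one_mul] at key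
  convert key using 2 <;> rfl

variable {p : ℕ} [Fact p.Prime]

/-- **Hom counts of the Heisenberg relation** (any field): for an abelian variety `X` with an action of a non-abelian
group `G` of order `p³`, subgroups `I, J` of order `p` not in `Z(G)`, and every `B`:
**`rk Hom(B_I, B) + rk Hom(B_{J Z(G)}, B) = rk Hom(B_J, B) + rk Hom(B_{I Z(G)}, B)`** (`B_L = Im N_L`, `End.of N_L = Σ_{x ∈ L} ρ x`).
[cite: KaniRosen1989, Thm. 3] [cite: BartelDokchitser2015, §1.1 Theorem A Case 2; §5 Theorem 4 (2)] [cite: DokchitserEtAl2022, §1.3 Thm. 1.3] -/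
theorem finrank_hom_pCubed (hG : Nat.card G = p ^ 3) (hna : ∃ a b : G, a * b ≠ b * a) {I J : Subgroup G}
    (hI : Nat.card I = p) (hJ : Nat.card J = p) (hIZ : ¬ I ≤ Subgroup.center G) (hJZ : ¬ J ≤ Subgroup.center G)
    [Fintype I] [Fintype J] [Fintype ↥(I ⊔ Subgroup.center G)] [Fintype ↥(J ⊔ Subgroup.center G)]
    {NI NJ NIZ NJZ : X ⟶ X} (hNI : End.of NI = ∑ x : I, ρ x) (hNJ : End.of NJ = ∑ x : J, ρ x)
    (hNIZ : End.of NIZ = ∑ x : ↥(I ⊔ Subgroup.center G), ρ x)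
    (hNJZ : End.of NJZ = ∑ x : ↥(J ⊔ Subgroup.center G), ρ x) (B : AbelianVariety K) :
    Module.finrank ℤ (image NI ⟶ B) + Module.finrank ℤ (image NJZ ⟶ B) =
      Module.finrank ℤ (image NJ ⟶ B) + Module.finrank ℤ (image NIZ ⟶ B) :=
  finrank_hom_add_eq_of_indClassFun_add_eq' ρ
    (indClassFun_add_indClassFun_sup_center_eq_of_card_eq_prime_cube hG hna hI hJ hIZ hJZ) hNI hNJ hNIZ hNJZ B

variable [PerfectField K]

/-- **`B_I × B_{J Z(G)} ∼ B_J × B_{I Z(G)}` over a perfect field** — the Kani–Rosen isogeny of Tornehave–Bouc's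
Heisenberg relation `I − IZ − J + JZ` (for curves with an action of a non-abelian group of order `p³`:
`J_{C/I} × J_{C/JZ} ∼ J_{C/J} × J_{C/IZ}`). [cite: KaniRosen1989, Thm. 3] [cite: BartelDokchitser2015, §5 Theorem 4 (2)] [cite: DokchitserEtAl2022, §1.3 Thm. 1.3] -/
theorem isIsogenous_pCubed (hG : Nat.card G = p ^ 3) (hna : ∃ a b : G, a * b ≠ b * a) {I J : Subgroup G}
    (hI : Nat.card I = p) (hJ : Nat.card J = p) (hIZ : ¬ I ≤ Subgroup.center G) (hJZ : ¬ J ≤ Subgroup.center G)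
    [Fintype I] [Fintype J] [Fintype ↥(I ⊔ Subgroup.center G)] [Fintype ↥(J ⊔ Subgroup.center G)]
    {NI NJ NIZ NJZ : X ⟶ X} (hNI : End.of NI = ∑ x : I, ρ x) (hNJ : End.of NJ = ∑ x : J, ρ x)
    (hNIZ : End.of NIZ = ∑ x : ↥(I ⊔ Subgroup.center G), ρ x)
    (hNJZ : End.of NJZ = ∑ x : ↥(J ⊔ Subgroup.center G), ρ x) :
    IsIsogenous (image NI ⊞ image NJZ) (image NJ ⊞ image NIZ) := by
  refine isIsogenous_iff_forall_finrank_hom_eq'.2 fun B ↦ ?_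
  rw [finrank_hom_biprod, finrank_hom_biprod]
  exact finrank_hom_pCubed ρ hG hna hI hJ hIZ hJZ hNI hNJ hNIZ hNJZ B

/-- **Dimensions: `dim B_I + dim B_{J Z(G)} = dim B_J + dim B_{I Z(G)}`** (perfect field).
[cite: KaniRosen1989, Thm. 3] [cite: BartelDokchitser2015, §5 Theorem 4 (2)] -/
theorem dim_pCubed (hG : Nat.card G = p ^ 3) (hna : ∃ a b : G, a * b ≠ b * a) {I J : Subgroup G}
    (hI : Nat.card I = p) (hJ : Nat.card J = p) (hIZ : ¬ I ≤ Subgroup.center G) (hJZ : ¬ J ≤ Subgroup.center G)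
    [Fintype I] [Fintype J] [Fintype ↥(I ⊔ Subgroup.center G)] [Fintype ↥(J ⊔ Subgroup.center G)]
    {NI NJ NIZ NJZ : X ⟶ X} (hNI : End.of NI = ∑ x : I, ρ x) (hNJ : End.of NJ = ∑ x : J, ρ x)
    (hNIZ : End.of NIZ = ∑ x : ↥(I ⊔ Subgroup.center G), ρ x)
    (hNJZ : End.of NJZ = ∑ x : ↥(J ⊔ Subgroup.center G), ρ x) :
    (image NI).dim + (image NJZ).dim = (image NJ).dim + (image NIZ).dim := by
  have h := (isIsogenous_pCubed ρ hG hna hI hJ hIZ hJZ hNI hNJ hNIZ hNJZ).dim_eq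
  rwa [dim_biprod, dim_biprod] at h

end KaniRosen

end AbelianVariety

end Literature.AlgebraicGeometry.Motives
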